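import Summits.CriticalPhenomena.PercolationContinuityZ3.Theorems.Transplant.SiteKNCorridor
import Summits.CriticalPhenomena.PercolationContinuityZ3.Theorems.Transplant.SiteSamePStarTransport
import Literature.Probability.Percolation.KozmaNitzanSteps
import HarnessLib

/-!
# SITE Kozma–Nitzan §4 — the site exploration scheme on the star carrier

builds on p205010 (kernel theorem, internal audit signed; external expert review pending).
Lane `prim-bschramm`, class C1a (site percolation on `ℤ³`); block (γ) of the SITE same-`p` witness
(`SiteSameP.SiteSamePWitnessZd`, socket p217536), prim-hp-8 lineage.  Site twin of the scheme half of
`L/KozmaNitzanScheme.lean` (`KSch.*`).  Helper file (`--supports stmt-CriticalPhenomena-4575`); definitions + the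
locality lemmas; no sorries.

The parameters are those of the bond scheme (`SKSch d` extends `KozmaNitzan.KSch d`: the cells `C`, the density `p`,
the threshold `δ`); the CELL GEOMETRY (`Q_v`, `M_v`, `E_{w,v}`, the stubs `H^j_{v,x}`, the cover) is the bond one verbatim.
What changes is the carrier: Kozma–Nitzan examine lattice EDGES, here the examinations read VERTEX states, encoded —
so that the abstract driver `HSiteScheme` / `Lawful` / site Theorem A (`SiteSameP.siteCriticalProb_lt_of_lawful`) apply
unchanged — as the star edges `{none, some v}` of the carrier `Option (Site d)` (`SiteStar.starEdge`, `starRead`):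

* `stars A` / `unstar F` — the star edges of a vertex set and back; `obsV σ A` — the open vertices of `A`;
* the explored region `V h = Q_0 ∪` (examined vertices), the recorded open vertices `ξ h`, the onward directions,
  the regions `Sx`, `Rj` (= `E_i ∪ E_{w,v} ∪ H^j_{v,x}`), the pinned-restricted weighting `Wt` of KN's (30), the
  good-connection predicate `cond`, `j_x = jOf`, the new / envelope regions, the revealed vertices, success `succV`;
* locality (`jOf_congr`, `revealV_congr`, `succV_congr`): everything the examination computes depends only on the
  states of the vertices it reveals;
* `probe h e : AProbe (Option (Site d))` (envelope = stars of the fresh envelope region), the success criterion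
  `succ h e o = succV h e (unstar o)`, the weighting `W₀` and the validity predicate of KN's (29)/(31)/(32), the
  explorer `nextProbe` and **`scheme : HSiteScheme (Option (Site d))`** with `U₀ = stars Q_0`.
[cite: KozmaNitzan2024, §4 pp. 25–28 (Definition of an exploration process, (29)–(32))] [cite: GrimmettPercolation1999, §1.6]
-/

noncomputable section

namespace Summit.CriticalPhenomena.PercolationContinuityZ3.Theorems.Transplant

namespace SiteKN

open MeasureTheory ProbabilityTheory
open Literature.Probability.Percolation Literature.Probability.LatticeModels
open Literature.Probability.Percolation.KozmaNitzan Literature.Probability.Percolation.KozmaNitzan.Cells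
open GadgetSystem ProbeHistory
open SiteTransplant (siteConn mem_siteConn)
open SiteStar (starEdge starRead starEdge_injective mem_starRead)
open scoped Classical

variable {d : ℕ}

/-! ## Star edges of vertex sets -/

/-- The star edges `{none, some v}`, `v ∈ A`. [folklore] -/
def stars (A : Finset (Site d)) : Finset (Sym2 (Option (Site d))) := A.map ⟨starEdge, starEdge_injective⟩

/-- The vertices whose star edge lies in `F`. [folklore] -/
def unstar (F : Finset (Sym2 (Option (Site d)))) : Finset (Site d) := F.preimage starEdge starEdge_injective.injOn

/-- The open vertices of `A` in the site configuration `σ`. [folklore] -/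
def obsV (σ : SiteConfig (Site d)) (A : Finset (Site d)) : Finset (Site d) := A.filter (· ∈ σ)

/-- Membership in `stars`. [folklore] -/
theorem mem_stars_iff {A : Finset (Site d)} {x : Sym2 (Option (Site d))} : x ∈ stars A ↔ ∃ v ∈ A, starEdge v = x := by
  simp [stars]

/-- `starEdge v ∈ stars A ↔ v ∈ A`. [folklore] -/
@[simp] theorem starEdge_mem_stars {A : Finset (Site d)} {v : Site d} : starEdge v ∈ stars A ↔ v ∈ A := by
  rw [mem_stars_iff]
  exact ⟨fun ⟨w, hw, h⟩ => starEdge_injective h ▸ hw, fun h => ⟨v, h, rfl⟩⟩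

/-- Membership in `unstar`. [folklore] -/
@[simp] theorem mem_unstar {F : Finset (Sym2 (Option (Site d)))} {v : Site d} : v ∈ unstar F ↔ starEdge v ∈ F := by
  simp [unstar]

/-- Membership in `obsV`. [folklore] -/
@[simp] theorem mem_obsV_iff {σ : SiteConfig (Site d)} {A : Finset (Site d)} {v : Site d} :
    v ∈ obsV σ A ↔ v ∈ A ∧ v ∈ σ := Finset.mem_filter

/-- `unstar (stars A) = A`. [folklore] -/
@[simp] theorem unstar_stars (A : Finset (Site d)) : unstar (stars A) = A := by
  ext v; simp

/-- `stars` as a set of star edges. [folklore] -/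
theorem coe_stars (A : Finset (Site d)) : (↑(stars A) : Set (Sym2 (Option (Site d)))) = starEdge '' ↑A := by
  ext x; simp [mem_stars_iff, eq_comm]

/-- `unstar` is monotone. [folklore] -/
theorem unstar_mono {F F' : Finset (Sym2 (Option (Site d)))} (h : F ⊆ F') : unstar F ⊆ unstar F' :=
  fun _ hv => mem_unstar.2 (h (mem_unstar.1 hv))

/-- `unstar` of a union. [folklore] -/
theorem unstar_union (F F' : Finset (Sym2 (Option (Site d)))) : unstar (F ∪ F') = unstar F ∪ unstar F' := by
  ext v; simp [Finset.mem_union]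

/-- **Reading the star edges of `A` on `ω` is reading the vertices of `A` on `starRead ω`.** [folklore] -/
theorem unstar_obs_stars (ω : BondConfig (Option (Site d))) (A : Finset (Site d)) :
    unstar (obs ω (stars A)) = obsV (starRead ω) A := by
  ext v
  simp only [mem_unstar, mem_obs_iff, starEdge_mem_stars, mem_obsV_iff, mem_starRead]

/-- `obsV σ A ⊆ A`. [folklore] -/
theorem obsV_subset (σ : SiteConfig (Site d)) (A : Finset (Site d)) : obsV σ A ⊆ A := Finset.filter_subset _ _

/-! ## The parameters -/

/-- **The parameters of the site exploration process**: the cells, the density `p` and the threshold `δ` of (30)/(32)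
— the record of the bond scheme (`KozmaNitzan.KSch`), whose cell geometry is reused verbatim.
[cite: KozmaNitzan2024, §4 pp. 25–27] -/
structure SKSch (d : ℕ) extends KSch d

namespace SKSch

variable (S : SKSch d)

/-- The initial vertices: the cube `Q_0`, all required open (KN: "`G₀ = {(0,0)}` if all edges of `Q_{(0,0)}` are
open"; here: all SITES). [cite: KozmaNitzan2024, §4 p. 27] -/
def U₀V : Finset (Site d) := S.C.Q 0

/-- **The explored region `E_i`**: `Q_0` and every vertex examined so far. [cite: KozmaNitzan2024, §4 p. 26 (E_i)] -/
def V (h : ProbeHistory (Option (Site d))) : Finset (Site d) := S.U₀V ∪ unstar (supp h)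

/-- The recorded open vertices (`Q_0` recorded open). [cite: KozmaNitzan2024, §4 p. 26 (ω|_{E_i})] -/
def ξ (h : ProbeHistory (Option (Site d))) : Finset (Site d) := S.U₀V ∪ unstar (KozmaNitzan.opens h)

/-- **The onward directions** out of `v`: the neighbours `x` whose centre is unexplored ((29)).
[cite: KozmaNitzan2024, §4 p. 27 (X = X_v), p. 26 (29)] -/
def onward (h : ProbeHistory (Option (Site d))) (v : Site 2) : Finset MDir :=
  Finset.univ.filter fun du => S.C.cen (v + stepVec du) ∉ S.V h

/-- The support of the examination of the connection `v–x` (`E_i ∪ E_{w,v} ∪ E_{v,x}`).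
[cite: KozmaNitzan2024, §4 p. 27 ((30): D ∪ E_{v,x})] -/
def Sx (h : ProbeHistory (Option (Site d))) (e : Site 2 × MDir) (du : MDir) : Finset (Site d) :=
  S.V h ∪ S.C.Ewv e.1 e.2 ∪ S.C.Efar (tgt e) du

/-- The conditioned region at stub level `j` (`D = E_i ∪ E_{w,v} ∪ H^j_{v,x}`). [cite: KozmaNitzan2024, §4 p. 27 ((30): D)] -/
def Rj (h : ProbeHistory (Option (Site d))) (e : Site 2 × MDir) (du : MDir) (j : ℕ) : Finset (Site d) :=
  S.V h ∪ S.C.Ewv e.1 e.2 ∪ S.C.Stub (tgt e) du j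

/-- The pattern pinned at level `j`: the recorded one on the explored vertices, the observed open vertices `o` on the
new ones. [cite: KozmaNitzan2024, §4 p. 27 ((30): ω|_D)] -/
def pat (h : ProbeHistory (Option (Site d))) (e : Site 2 × MDir) (du : MDir) (j : ℕ) (o : Finset (Site d)) :
    Finset (Site d) :=
  S.ξ h ∪ (o ∩ (S.Rj h e du j \ S.V h))

/-- **The weighting of (30)**: density `p` pinned on the pattern of `D` and restricted to `D ∪ E_{v,x}`.
[cite: KozmaNitzan2024, §4 p. 27 ((30))] -/
def Wt (h : ProbeHistory (Option (Site d))) (e : Site 2 × MDir) (du : MDir) (j : ℕ) (o : Finset (Site d)) :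
    Site d → unitInterval :=
  siteRestrW (↑(S.Sx h e du) : Set (Site d)) (pinW (fun _ : Site d => S.p) ↑(S.Rj h e du j) ↑(S.pat h e du j o))

/-- The target event `{0 ↔^{site} M_x}`. [cite: KozmaNitzan2024, §4 p. 27 ((30): 0 ↔ M_x)] -/
def Conn (e : Site 2 × MDir) (du : MDir) : Set (SiteConfig (Site d)) :=
  ⋃ t ∈ S.C.M (tgt e + stepVec du), siteConn (zdGraph d) (0 : Site d) t

/-- **(30)**: the connection `v–x` is good at level `j` given the observed open vertices `o`.
[cite: KozmaNitzan2024, §4 p. 27 ((30))] -/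
def cond (h : ProbeHistory (Option (Site d))) (e : Site 2 × MDir) (du : MDir) (j : ℕ) (o : Finset (Site d)) : Prop :=
  1 - S.δc < (prodBernoulli (S.Wt h e du j o)).real (S.Conn e du)

/-- `j_x`: the first good level, or `K - 1`. [cite: KozmaNitzan2024, §4 p. 27 (j_x)] -/
def jOf (h : ProbeHistory (Option (Site d))) (e : Site 2 × MDir) (du : MDir) (o : Finset (Site d)) : ℕ :=
  jIdx S.C.K fun j => S.cond h e du j o

/-- The region revealed by the examination, given the observation (`E_{w,v} ∪ ⋃_x H^{j_x}_{v,x}`).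
[cite: KozmaNitzan2024, §4 p. 27 (E_{i+1})] -/
def newRegion (h : ProbeHistory (Option (Site d))) (e : Site 2 × MDir) (o : Finset (Site d)) : Finset (Site d) :=
  S.C.Ewv e.1 e.2 ∪ (S.onward h (tgt e)).biUnion fun du => S.C.Stub (tgt e) du (S.jOf h e du o)

/-- The envelope region (`E_{w,v} ∪ ⋃_x H^{K-1}_{v,x}`). [cite: KozmaNitzan2024, §4 p. 27] -/
def envRegion (h : ProbeHistory (Option (Site d))) (e : Site 2 × MDir) : Finset (Site d) :=
  S.C.Ewv e.1 e.2 ∪ (S.onward h (tgt e)).biUnion fun du => S.C.Stub (tgt e) du (S.C.K - 1)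

/-- The envelope of the examination: the fresh vertices of the envelope region. [cite: KozmaNitzan2024, §4 p. 27] -/
def envV (h : ProbeHistory (Option (Site d))) (e : Site 2 × MDir) : Finset (Site d) := S.envRegion h e \ S.V h

/-- The revealed vertices given the observation: the fresh vertices of the new region. [cite: KozmaNitzan2024, §4 p. 27 (E_{i+1})] -/
def revealV (h : ProbeHistory (Option (Site d))) (e : Site 2 × MDir) (o : Finset (Site d)) : Finset (Site d) :=
  S.newRegion h e o \ S.V h

/-- **Success** ("declare `v` good … if all connections to all `x ∈ X` are good", p. 27), reading open vertices.
[cite: KozmaNitzan2024, §4 p. 27] -/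
def succV (h : ProbeHistory (Option (Site d))) (e : Site 2 × MDir) (o : Finset (Site d)) : Prop :=
  ∀ du ∈ S.onward h (tgt e), S.cond h e du (S.jOf h e du o) o

/-! ### Locality -/

/-- `j_x < K`. [folklore] -/
theorem jOf_lt (h : ProbeHistory (Option (Site d))) (e : Site 2 × MDir) (du : MDir) (o : Finset (Site d)) :
    S.jOf h e du o < S.C.K :=
  jIdx_lt (by have := S.C.hK; omega) _

/-- The new region lies in the envelope region. [folklore] -/
theorem newRegion_subset_envRegion (h : ProbeHistory (Option (Site d))) (e : Site 2 × MDir) (o : Finset (Site d)) :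
    S.newRegion h e o ⊆ S.envRegion h e := by
  intro y hy
  rcases Finset.mem_union.1 hy with hy | hy
  · exact Finset.mem_union_left _ hy
  · refine Finset.mem_union_right _ ?_
    rw [Finset.mem_biUnion] at hy ⊢
    obtain ⟨du, hdu, hy⟩ := hy
    exact ⟨du, hdu, S.C.stub_mono _ _ (by have := S.jOf_lt h e du o; omega) hy⟩

/-- The revealed vertices lie in the envelope. [folklore] -/
theorem revealV_subset_envV (h : ProbeHistory (Option (Site d))) (e : Site 2 × MDir) (o : Finset (Site d)) :
    S.revealV h e o ⊆ S.envV h e :=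
  Finset.sdiff_subset_sdiff (S.newRegion_subset_envRegion h e o) le_rfl

/-- The conditioned region at level `j ≤ j'` lies in that of level `j'`. [folklore] -/
theorem Rj_mono (h : ProbeHistory (Option (Site d))) (e : Site 2 × MDir) (du : MDir) {j j' : ℕ} (hjj' : j ≤ j') :
    S.Rj h e du j ⊆ S.Rj h e du j' :=
  Finset.union_subset_union le_rfl (S.C.stub_mono _ _ hjj')

/-- The explored region lies in every conditioned region. [folklore] -/
theorem V_subset_Rj (h : ProbeHistory (Option (Site d))) (e : Site 2 × MDir) (du : MDir) (j : ℕ) : S.V h ⊆ S.Rj h e du j :=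
  fun _ hy => Finset.mem_union_left _ (Finset.mem_union_left _ hy)

/-- The conditioned region lies in `E_i ∪` the new region, up to level `j_x`. [folklore] -/
theorem Rj_subset_V_union_newRegion {h : ProbeHistory (Option (Site d))} {e : Site 2 × MDir} {du : MDir}
    (hdu : du ∈ S.onward h (tgt e)) {o : Finset (Site d)} {j : ℕ} (hj : j ≤ S.jOf h e du o) :
    S.Rj h e du j ⊆ S.V h ∪ S.newRegion h e o := by
  intro y hy
  rcases Finset.mem_union.1 hy with hy | hy
  · rcases Finset.mem_union.1 hy with hy | hy
    · exact Finset.mem_union_left _ hy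
    · exact Finset.mem_union_right _ (Finset.mem_union_left _ hy)
  · exact Finset.mem_union_right _ (Finset.mem_union_right _ (Finset.mem_biUnion.2 ⟨du, hdu, S.C.stub_mono _ _ hj hy⟩))

/-- The new conditioned vertices at level `j ≤ j_x` of an onward direction are revealed. [folklore] -/
theorem Rj_sdiff_subset_revealV {h : ProbeHistory (Option (Site d))} {e : Site 2 × MDir} {du : MDir}
    (hdu : du ∈ S.onward h (tgt e)) {o : Finset (Site d)} {j : ℕ} (hj : j ≤ S.jOf h e du o) :
    S.Rj h e du j \ S.V h ⊆ S.revealV h e o := by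
  intro y hy
  obtain ⟨hyR, hyV⟩ := Finset.mem_sdiff.1 hy
  refine Finset.mem_sdiff.2 ⟨?_, hyV⟩
  rcases Finset.mem_union.1 (S.Rj_subset_V_union_newRegion hdu hj hyR) with h' | h'
  · exact absurd h' hyV
  · exact h'

/-- The new conditioned vertices of an onward direction lie in the envelope (`j < K`). [folklore] -/
theorem Rj_sdiff_subset_envV (h : ProbeHistory (Option (Site d))) (e : Site 2 × MDir) {du : MDir}
    (hdu : du ∈ S.onward h (tgt e)) {j : ℕ} (hj : j < S.C.K) : S.Rj h e du j \ S.V h ⊆ S.envV h e := by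
  intro y hy
  obtain ⟨hyR, hyV⟩ := Finset.mem_sdiff.1 hy
  refine Finset.mem_sdiff.2 ⟨?_, hyV⟩
  rcases Finset.mem_union.1 hyR with hy' | hy'
  · rcases Finset.mem_union.1 hy' with hy'' | hy''
    · exact absurd hy'' hyV
    · exact Finset.mem_union_left _ hy''
  · exact Finset.mem_union_right _ (Finset.mem_biUnion.2 ⟨du, hdu, S.C.stub_mono _ _ (by omega) hy'⟩)

/-- The pattern only depends on the observation on the new conditioned vertices. [folklore] -/
theorem pat_congr (h : ProbeHistory (Option (Site d))) (e : Site 2 × MDir) (du : MDir) (j : ℕ) {o o' : Finset (Site d)}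
    (hoo' : ∀ x ∈ S.Rj h e du j \ S.V h, x ∈ o ↔ x ∈ o') : S.pat h e du j o = S.pat h e du j o' := by
  unfold pat
  congr 1
  ext x
  simp only [Finset.mem_inter]
  constructor
  · rintro ⟨hx, hx'⟩; exact ⟨(hoo' x hx').1 hx, hx'⟩
  · rintro ⟨hx, hx'⟩; exact ⟨(hoo' x hx').2 hx, hx'⟩

/-- Hence so does the good-connection predicate. [folklore] -/
theorem cond_congr (h : ProbeHistory (Option (Site d))) (e : Site 2 × MDir) (du : MDir) (j : ℕ) {o o' : Finset (Site d)}
    (hoo' : ∀ x ∈ S.Rj h e du j \ S.V h, x ∈ o ↔ x ∈ o') : S.cond h e du j o ↔ S.cond h e du j o' := by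
  unfold cond Wt
  rw [S.pat_congr h e du j hoo']

/-- **Locality of `j_x`**: observations agreeing on the revealed vertices give the same `j_x` and the same goodness at
`j_x`, for every onward direction. [folklore] -/
theorem jOf_congr {h : ProbeHistory (Option (Site d))} {e : Site 2 × MDir} {du : MDir} (hdu : du ∈ S.onward h (tgt e))
    {o o' : Finset (Site d)} (hoo' : ∀ x ∈ S.revealV h e o, x ∈ o ↔ x ∈ o') :
    S.jOf h e du o' = S.jOf h e du o ∧
      (S.cond h e du (S.jOf h e du o) o' ↔ S.cond h e du (S.jOf h e du o) o) := by
  have key : ∀ j ≤ S.jOf h e du o, (S.cond h e du j o ↔ S.cond h e du j o') := fun j hj =>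
    S.cond_congr h e du j fun x hx => hoo' x (S.Rj_sdiff_subset_revealV hdu hj hx)
  exact ⟨jIdx_congr key, (key _ le_rfl).symm⟩

/-- **Locality of the revealed set.** [folklore] -/
theorem revealV_congr {h : ProbeHistory (Option (Site d))} {e : Site 2 × MDir} {o o' : Finset (Site d)}
    (hoo' : ∀ x ∈ S.revealV h e o, x ∈ o ↔ x ∈ o') : S.revealV h e o' = S.revealV h e o := by
  unfold revealV newRegion
  have : ∀ du ∈ S.onward h (tgt e), S.jOf h e du o' = S.jOf h e du o := fun du hdu => (S.jOf_congr hdu hoo').1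
  rw [Finset.biUnion_congr rfl fun du hdu => by rw [this du hdu]]

/-- **Locality of success.** [folklore] -/
theorem succV_congr {h : ProbeHistory (Option (Site d))} {e : Site 2 × MDir} {o o' : Finset (Site d)}
    (hoo' : ∀ x ∈ S.revealV h e o, x ∈ o ↔ x ∈ o') : S.succV h e o' ↔ S.succV h e o := by
  unfold succV
  refine forall₂_congr fun du hdu => ?_
  obtain ⟨h1, h2⟩ := S.jOf_congr hdu hoo'
  rw [h1, h2]

/-! ### The probe (on the star carrier) -/

/-- **The adaptive probe of the examination of `v = tgt e` from `e.1`**, reading vertex states through their star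
edges: envelope = the star edges of the fresh envelope region; it reveals `E_{w,v}` and the stubs `H^{j_x}_{v,x}`,
computing the `j_x` from what it sees. [cite: KozmaNitzan2024, §4 p. 27] -/
def probe (h : ProbeHistory (Option (Site d))) (e : Site 2 × MDir) : AProbe (Option (Site d)) where
  env := stars (S.envV h e)
  reveal := fun ω => stars (S.revealV h e (unstar (obs ω (stars (S.envV h e)))))
  reveal_subset := fun ω => Finset.map_subset_map.2 (S.revealV_subset_envV h e _)
  reveal_local := by
    intro ω ω' hag
    have key : S.revealV h e (unstar (obs ω' (stars (S.envV h e)))) = S.revealV h e (unstar (obs ω (stars (S.envV h e)))) := by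
      refine S.revealV_congr fun x hx => ?_
      have hxe : x ∈ S.envV h e := S.revealV_subset_envV h e _ hx
      simp only [mem_unstar, mem_obs_iff, starEdge_mem_stars, hxe, true_and]
      exact hag (starEdge x) (by rw [starEdge_mem_stars]; exact hx)
    rw [key]

/-- The success criterion on the star carrier: read the open vertices off the observed star edges.
[cite: KozmaNitzan2024, §4 p. 27] -/
def succ (h : ProbeHistory (Option (Site d))) (e : Site 2 × MDir) (o : Finset (Sym2 (Option (Site d)))) : Prop :=
  S.succV h e (unstar o)

/-- The observation of the probe agrees with the observation of the envelope on the revealed vertices, so success read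
off either is the same; both are `succV` at the open vertices of the envelope region of `starRead ω`. [folklore] -/
theorem succ_read_iff (h : ProbeHistory (Option (Site d))) (e : Site 2 × MDir) (ω : BondConfig (Option (Site d))) :
    S.succ h e ((S.probe h e).read ω) ↔ S.succV h e (obsV (starRead ω) (S.envV h e)) := by
  unfold succ
  rw [← unstar_obs_stars]
  refine S.succV_congr fun x hx => ?_
  have hxe : x ∈ S.envV h e := S.revealV_subset_envV h e _ hx
  simp only [AProbe.read, probe, mem_unstar, mem_obs_iff, starEdge_mem_stars, hxe, hx, true_and]

/-! ### Validity and the scheme -/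

/-- The weighting of (32): density `p` pinned on the recorded pattern of `E_i`, restricted to `E_i ∪ E_{w,v}`.
[cite: KozmaNitzan2024, §4 p. 28 ((32))] -/
def W₀ (h : ProbeHistory (Option (Site d))) (e : Site 2 × MDir) : Site d → unitInterval :=
  siteRestrW (↑(S.V h ∪ S.C.Ewv e.1 e.2) : Set (Site d)) (pinW (fun _ : Site d => S.p) ↑(S.V h) ↑(S.ξ h))

/-- **Valid histories** for the examination along `e`: the recorded open vertices are explored, the origin and the
source's centre are explored, the explored region is separated from `Q_v` and from the `E_{v,x}` of the onward directions
((29), (31)), and (32) holds: `P(0 ↔ M_v in E_i ∪ E_{w,v} | sites of E_i) > 1 − δ`.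
[cite: KozmaNitzan2024, §4 pp. 26–28 ((29), (31), (32))] -/
structure Valid (h : ProbeHistory (Option (Site d))) (e : Site 2 × MDir) : Prop where
  /-- recorded open vertices are explored -/
  ξ_sub : S.ξ h ⊆ S.V h
  /-- the origin is explored -/
  zero_mem : (0 : Site d) ∈ S.V h
  /-- the source's centre is explored -/
  src_mem : S.C.cen e.1 ∈ S.V h
  /-- the cover property ((29), (31)) -/
  cover : ∃ det : Set (Site 2), tgt e ∉ det ∧ (∀ du ∈ S.onward h (tgt e), tgt e + stepVec du ∉ det) ∧
    (↑(S.V h) : Set (Site d)) ⊆ S.C.Cover det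
  /-- (32) -/
  reach : 1 - S.δc < (prodBernoulli (S.W₀ h e)).real (⋃ t ∈ S.C.M (tgt e), siteConn (zdGraph d) (0 : Site d) t)

/-- The next probe: examine the chosen candidate, but only after a valid history. [cite: KozmaNitzan2024, §4 p. 27] -/
def nextProbe (h : ProbeHistory (Option (Site d))) : Option (AProbe (Option (Site d))) :=
  match (HSiteScheme.mstOf S.succ h).choice with
  | none => none
  | some e => if S.Valid h e then some (S.probe h e) else none

/-- **The site exploration process** as a history-driven scheme on the star carrier `Option (Site d)`.
[cite: KozmaNitzan2024, §4 pp. 26–27] -/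
def scheme : HSiteScheme (Option (Site d)) := ⟨⟨S.nextProbe⟩, stars S.U₀V, S.succ⟩

/-- If a probe is made, the history is valid for the chosen edge and the probe is the examination. [folklore] -/
theorem nextProbe_eq_some {h : ProbeHistory (Option (Site d))} {P : AProbe (Option (Site d))} (hP : S.nextProbe h = some P) :
    ∃ e, (HSiteScheme.mstOf S.succ h).choice = some e ∧ S.Valid h e ∧ P = S.probe h e := by
  unfold nextProbe at hP
  cases hc : (HSiteScheme.mstOf S.succ h).choice with
  | none => rw [hc] at hP; simp at hP
  | some e =>
    rw [hc] at hP
    simp only at hP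
    split_ifs at hP with hV
    rw [Option.some.injEq] at hP
    exact ⟨e, rfl, hV, hP.symm⟩

/-- Conversely a valid history with a candidate is probed. [folklore] -/
theorem nextProbe_of_valid {h : ProbeHistory (Option (Site d))} {e : Site 2 × MDir}
    (hc : (HSiteScheme.mstOf S.succ h).choice = some e) (hV : S.Valid h e) : S.nextProbe h = some (S.probe h e) := by
  unfold nextProbe; rw [hc]; simp only; rw [if_pos hV]

end SKSch

end SiteKN

end Summit.CriticalPhenomena.PercolationContinuityZ3.Theorems.Transplant

end
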